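import Summits.QuantumFields.YangMills.Theorems.EquipartitionCriticalityFreeEnergyLogCoefficient
import Summits.QuantumFields.YangMills.Theorems.EntropyBudgetEquipartitionFreeEnergyRateStubMaxwellRate
import Summits.QuantumFields.YangMills.Theorems.EntropyBudgetEquipartitionFreeEnergyRateStubUpperRate
import Summits.QuantumFields.YangMills.Theorems.EntropyBudgetEquipartitionFreeEnergyRateStubLowerRate
import HarnessLib

/-!
# KS2″ `SourcedPressureDecoupling` (stmt-QuantumFields-24296), line «exact-seam», stub `stub_seamFE`:
# the finite-size free-energy comparison at weak coupling (windowed Chatterjee §17)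

For every compact simple `G`, lattice representation `r` and `0 < θ ≤ 1/64` there are `κ₁ > 0`, `β₀` with

  `F(B_s, β) − f(β) ≤ β^(−κ₁)`   for `β ≥ β₀` and every cube of `s` sites per axis with `β^θ ≤ s ≤ 4β^θ`,

where `F(B_s, β) = log Z(B_s, β)/s⁴` is Sweep1's `freeEnergyPerSite` of the free-boundary cube and `f(β)` is the torus free energy
density `freeEnergyDensity 4 r.ρ β`.  (The reverse inequality `f ≤ ((s/(s+1))⁴ F(B_s)` is Lemma 17.3,
`ChatterjeeFreeEnergy.freeEnergyDensity_le`; so this says the free cell's free energy per site exceeds the infinite-volume one by at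
most `β^(−κ₁)` once the cell has `≥ β^θ` sites per axis — the `(D/2)·log β` per crossing link of the seam, `≍ β^(−θ) log β` per site.)

Proof (all ingredients are the tree's mechanised Chatterjee, arXiv:1602.01222 §17, for the abstract one-box interface
`B := exists_oneBoxBounds r.ρ`): (i) `T_le_window` — Lemma 17.2 in logarithmic form at ANY scale `m ≤ β^{a_U}`
(`OneBoxBounds.T_le_G_add`, `rho0_le_half_r₁`, `errU_sq_le`, `FreeEnergyRate.abs_Gm_sub_le`): `T(B_m, β) ≤ A₀ + β^(−κ_U)` uniformly for
`β^θ ≤ 2m`, `m ≤ β^{a_U}`, `A₀ = (d−1) log c_H + D·L_M` (the body of `FreeEnergyRate.stub_upperRate` without the Lemma-17.3 descent);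
(ii) `freeEnergyDensity_lower` — the quantitative lower joint bound `FreeEnergyRate.stub_lowerRate` passed to the torus density at fixed `β`
(`ChatterjeeFreeEnergy.tendsto_freeEnergyPerSite_halfOpenBox`, boundary-condition independence): `f(β) + (3D/2) log β ≥ A₀ − β^(−κ₂)`;
(iii) `F(B_s,β) − f(β) = T(B_s,β) − ½(3 − 4/s + s⁻⁴)D log β − f(β) ≤ β^(−κ_U) + β^(−κ₂) + 2Dβ^(−θ) log β ≤ β^(−κ₁)`
(`ChatterjeeJointLimit.coef_eq`; `4β^θ ≤ β^{a_U}` because `θ ≤ 1/64 < a_U(4) = 1/30`).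

Helper for the CLOSED (superseded) route `SourcedPressureJensen` — an instrument statement; RECORD-label rung R2xi-G was closed by
`ColdBoxAllGroups`; the Yang–Mills mass gap is NOT proved by anything here.
-/

noncomputable section

open scoped Matrix.Norms.Frobenius ENNReal NNReal
open MeasureTheory Measure Filter Topology Set
open Literature.Probability.LatticeModels Literature.MathematicalPhysics.QuantumLattice
open Literature.MathematicalPhysics.QuantumFieldTheory
open Summit.QuantumFields.YangMills.Theorems.FreeEnergyLogCoefficient
open Summit.QuantumFields.YangMills.Theorems.FreeEnergyRate
open ChatterjeeJointLimit WilsonWeakCoupling LatticeMaxwell ChatterjeeAssembly AxialGauge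

namespace Summit.QuantumFields.YangMills.Cruxes.SourcedPressureDecoupling.EntropicSeam

/-! ### (i) The windowed one-box upper bound (Lemma 17.2 at every scale `m ≤ β^{a_U}`) -/

/-- **Windowed upper bound for the normalised free energy.**  For an abstract one-box interface `B` and a Maxwell rate
`|log Z_M(B_n)/n^d − L| ≤ C/√n`: for every `θ > 0` there is `κ > 0` such that for all large `β` and EVERY cube side `m` with
`β^θ ≤ 2m` and `m ≤ β^{a_U}`, `T(B_m, β) ≤ (d−1) log c_H + D L + β^(−κ)` (Lemma 17.2 in F-form at the scale `m`, the cubic chart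
error `≤ 8Ad²V(β)`, and `|G(m) − A₀| ≤ (d+1)|log c_H|/m + DC/√m`; every error is `O(β^(−θ/2) + V(β))`). [cite: arXiv160201222, Lemmas 17.2, 17.4] -/
theorem T_le_window {d : ℕ} (hd : 2 ≤ d) (B : OneBoxBounds d) {L C : ℝ}
    (hL : ∀ n : ℕ, 1 ≤ n → |ChatterjeeAssembly.logZM d n / (n : ℝ) ^ d - L| ≤ C / Real.sqrt n)
    {θ : ℝ} (hθ : 0 < θ) :
    ∃ κ : ℝ, 0 < κ ∧ ∀ᶠ β : ℝ in atTop, ∀ m : ℕ, β ^ θ ≤ 2 * (m : ℝ) → (m : ℝ) ≤ β ^ aU d →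
      B.T m β ≤ ((d : ℝ) - 1) * Real.log B.cH + (B.D : ℝ) * L + β ^ (-κ) := by
  have hd1 : 1 ≤ d := by omega
  have hC0 : 0 ≤ C := rate_const_nonneg hL
  have hC71 := B.C71_pos
  have hA := B.A_nonneg
  have hD : (0 : ℝ) ≤ (B.D : ℝ) := Nat.cast_nonneg _
  set a := aU d with ha
  have ha0 : 0 < a := aU_pos
  have ha6 : a ≤ 1 / 6 := aU_le
  set κ := min (θ / 4) (a / 4) with hκ
  have hκθ : κ ≤ θ / 4 := min_le_left _ _
  have hκa : κ ≤ a / 4 := min_le_right _ _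
  have hκ0 : 0 < κ := lt_min (by positivity) (by positivity)
  refine ⟨κ, hκ0, ?_⟩
  set A₀ : ℝ := ((d : ℝ) - 1) * Real.log B.cH + (B.D : ℝ) * L with hA₀
  set P : ℝ := 2 * (((d : ℝ) + 1) * |Real.log B.cH| + Real.log 2) with hP
  set R : ℝ := (B.D : ℝ) * C * Real.sqrt 2 with hR
  set S : ℝ := 8 * B.A * (d : ℝ) ^ 2 with hS
  set E : ℝ → ℝ := fun β => P * β ^ (-θ) + R * β ^ (-(θ / 2)) + S * Vf d B.C71 β with hE
  have hEt : Tendsto (fun β => β ^ κ * E β) atTop (𝓝 0) := by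
    have t1 := (tendsto_rpow_mul_rpow (κ := κ) (p := -θ) (by linarith)).const_mul P
    have t3 := (tendsto_rpow_mul_rpow (κ := κ) (p := -(θ / 2)) (by linarith)).const_mul R
    have t4 := (tendsto_rpow_mul_rpow_mul_log (κ := κ) (p := -(1 / 6 : ℝ)) (by linarith)).const_mul
      (S * (2 * d * B.C71))
    have t5 := (tendsto_rpow_mul_rpow (κ := κ) (p := aU d - 1 / 3) (by linarith)).const_mul
      (S * (2 * d * Real.log 2))
    have hsum := (t1.add t3).add (t4.add t5)
    simp only [mul_zero, add_zero] at hsum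
    refine hsum.congr' (Eventually.of_forall fun β => ?_)
    simp only [hE, Vf]
    ring
  have hev : ∀ᶠ β : ℝ in atTop, 2 ≤ β ∧ Sbar d B.C71 β ≤ (B.r₁ / 2) ^ 2 ∧ Vf d B.C71 β ≤ 1 ∧
      E β ≤ β ^ (-κ) := by
    refine (eventually_ge_atTop 2).and (Eventually.and ?_ (Eventually.and ?_ ?_))
    · exact (OneBoxBounds.tendsto_Sbar (d := d) B.C71).eventually
        (ge_mem_nhds (by have := B.r₁_pos; positivity))
    · exact (tendsto_Vf (d := d) B.C71).eventually (ge_mem_nhds zero_lt_one)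
    · exact eventually_le_rpow_neg_of_tendsto hEt
  filter_upwards [hev] with β ⟨hβ2, hSb, hV1, hEle⟩
  intro m hmlo hma
  have hβ0 : 0 < β := by linarith
  have hβ1 : 1 ≤ β := by linarith
  have hL0 : 0 ≤ Real.log β := Real.log_nonneg hβ1
  have hβθ : 0 < β ^ θ := Real.rpow_pos_of_pos hβ0 θ
  have hm0 : (0 : ℝ) < m := by linarith
  have hm1 : 1 ≤ m := by
    rcases Nat.eq_zero_or_pos m with h | h
    · subst h; simp at hm0
    · exact h
  have hm1r : (1 : ℝ) ≤ m := by exact_mod_cast hm1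
  -- Lemma 17.2 at `m`
  have hρ := B.rho0_le_half_r₁ hβ1 hma hSb
  have hTm := B.T_le_G_add hβ2 hm1 hρ
  -- the cubic error `≤ S V(β)`
  set U : ℝ := B.A * β * (2 * rho0 B.C71 d m β) ^ 3 * ((d : ℝ) * d) with hU
  have hU0 : 0 ≤ U := by have := rho0_nonneg B.C71 d m β; positivity
  have hV0 : 0 ≤ Vf d B.C71 β := Vf_nonneg hC71.le hβ1
  have hVmax : max (Vf d B.C71 β) 0 = Vf d B.C71 β := max_eq_left hV0
  have hUsq := B.errU_sq_le hβ1 hma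
  rw [hVmax] at hUsq
  have hUle : U ≤ S * Vf d B.C71 β := by
    have hV3 : Vf d B.C71 β ^ 3 ≤ Vf d B.C71 β ^ 2 := pow_le_pow_of_le_one hV0 hV1 (by norm_num)
    have h2 : U ^ 2 ≤ (S * Vf d B.C71 β) ^ 2 := by
      calc U ^ 2 ≤ 64 * B.A ^ 2 * (d : ℝ) ^ 4 * Vf d B.C71 β ^ 3 := hUsq
        _ ≤ 64 * B.A ^ 2 * (d : ℝ) ^ 4 * Vf d B.C71 β ^ 2 := by gcongr
        _ = (S * Vf d B.C71 β) ^ 2 := by rw [hS]; ring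
    exact (pow_le_pow_iff_left₀ hU0 (by positivity) two_ne_zero).1 h2
  -- the main term
  have hG := abs_Gm_sub_le hd1 B hL hm1
  have hG' : B.Gm m ≤ A₀ + ((d : ℝ) + 1) * |Real.log B.cH| / m + (B.D : ℝ) * C / Real.sqrt m := by
    have := (abs_le.1 hG).2; linarith
  -- conversions `1/m ≤ 2β^{-θ}`, `1/√m ≤ √2 β^{-θ/2}`, `1/m^d ≤ 1/m`
  have hw2 : 1 / (m : ℝ) ≤ 2 / β ^ θ := by
    rw [div_le_div_iff₀ hm0 hβθ]; linarith
  have hinv : 1 / (m : ℝ) ≤ 2 * β ^ (-θ) := by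
    rw [Real.rpow_neg hβ0.le, ← div_eq_mul_inv]; exact hw2
  have hmd : (m : ℝ) ≤ (m : ℝ) ^ d := le_self_pow₀ hm1r (by omega)
  have hinvd : 1 / (m : ℝ) ^ d ≤ 2 * β ^ (-θ) :=
    (div_le_div_of_nonneg_left zero_le_one hm0 hmd).trans hinv
  have hsqrt : 1 / Real.sqrt m ≤ Real.sqrt 2 * β ^ (-(θ / 2)) := by
    have h1 : Real.sqrt (1 / (m : ℝ)) ≤ Real.sqrt (2 * β ^ (-θ)) := Real.sqrt_le_sqrt hinv
    rw [Real.sqrt_div' 1 hm0.le, Real.sqrt_one, Real.sqrt_mul' 2 (Real.rpow_nonneg hβ0.le _),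
      Real.sqrt_eq_rpow (β ^ (-θ)), ← Real.rpow_mul hβ0.le] at h1
    have e : -θ * (1 / (2 : ℝ)) = -(θ / 2) := by ring
    rwa [e] at h1
  -- assemble
  have e1 : ((d : ℝ) + 1) * |Real.log B.cH| / m ≤ ((d : ℝ) + 1) * |Real.log B.cH| * (2 * β ^ (-θ)) := by
    rw [div_eq_mul_one_div]
    exact mul_le_mul_of_nonneg_left hinv (by positivity)
  have e2 : (B.D : ℝ) * C / Real.sqrt m ≤ (B.D : ℝ) * C * (Real.sqrt 2 * β ^ (-(θ / 2))) := by
    rw [div_eq_mul_one_div]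
    exact mul_le_mul_of_nonneg_left hsqrt (by positivity)
  have e3 : Real.log 2 / (m : ℝ) ^ d ≤ Real.log 2 * (2 * β ^ (-θ)) := by
    rw [div_eq_mul_one_div]
    exact mul_le_mul_of_nonneg_left hinvd (Real.log_nonneg one_le_two)
  have hEβ : E β = P * β ^ (-θ) + R * β ^ (-(θ / 2)) + S * Vf d B.C71 β := rfl
  have htot : B.T m β ≤ A₀ + E β := by
    rw [hEβ, hP, hR]
    linarith [hTm, hUle, hG', e1, e2, e3]
  linarith

/-! ### (ii) The torus lower rate from the lower joint bound -/

/-- **The lower joint bound passes to the torus density.**  If `B.logZ` is the free-cube partition function of `r.ρ` (`d = 4`) and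
`A₀ − β^(−κ) ≤ T(B_n, β)` for all large `β` and, at each such `β`, all large `n`, then for all large `β`,
`A₀ − β^(−κ) ≤ f(β) + (3/2)·D·log β`: at fixed `β`, `F(B_n, β) → f(β)` (`tendsto_freeEnergyPerSite_halfOpenBox`,
boundary-condition independence), `coef n = 3 − 4/n + n⁻⁴ → 3` (`coef_eq`, `tendsto_coeff`), and `ge_of_tendsto`. [cite: arXiv160201222, Thm. 2.1, §17] -/
theorem freeEnergyDensity_lower {G : Type} [Group G] [TopologicalSpace G] [IsTopologicalGroup G]
    [CompactSpace G] [MeasurableSpace G] [BorelSpace G] (r : LatticeRep G) (B : OneBoxBounds 4)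
    (hBlog : B.logZ = fun n β => Real.log (zdPartitionFunction r.ρ β (halfOpenBox 4 n)).toReal)
    {A₀ κ : ℝ} (h : ∀ᶠ β : ℝ in atTop, ∀ᶠ n : ℕ in atTop, A₀ - β ^ (-κ) ≤ B.T n β) :
    ∀ᶠ β : ℝ in atTop, A₀ - β ^ (-κ) ≤ freeEnergyDensity 4 r.ρ β + 3 / 2 * (B.D : ℝ) * Real.log β := by
  haveI : SecondCountableTopology (Matrix (Fin r.N) (Fin r.N) ℂ) :=
    inferInstanceAs (SecondCountableTopology (Fin r.N → Fin r.N → ℂ))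
  haveI : SecondCountableTopology G :=
    (r.continuous.isClosedEmbedding r.injective).isEmbedding.secondCountableTopology
  filter_upwards [h] with β hβ
  have h1 := ChatterjeeFreeEnergy.tendsto_freeEnergyPerSite_halfOpenBox (d := 4) r.ρ r.continuous β
  have h2 := ChatterjeeFreeEnergy.tendsto_coeff (m := 4) (by norm_num) (1 / 2 : ℝ) ((B.D : ℝ) * Real.log β)
  have h3 := h1.add h2
  have hlim : freeEnergyDensity 4 r.ρ β + (1 / 2 : ℝ) * (((4 : ℕ) : ℝ) - 1) * ((B.D : ℝ) * Real.log β) =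
      freeEnergyDensity 4 r.ρ β + 3 / 2 * (B.D : ℝ) * Real.log β := by
    push_cast
    ring
  rw [hlim] at h3
  have h4 : Tendsto (fun n : ℕ => B.T n β) atTop
      (𝓝 (freeEnergyDensity 4 r.ρ β + 3 / 2 * (B.D : ℝ) * Real.log β)) := by
    refine h3.congr' ?_
    filter_upwards [eventually_ge_atTop 1] with n hn1
    symm
    rw [OneBoxBounds.T, OneBoxBounds.F, hBlog, ChatterjeeJointLimit.coef_eq (by norm_num) hn1,
      ChatterjeeFreeEnergy.freeEnergyPerSite_halfOpenBox_eq]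
    push_cast
    ring
  exact ge_of_tendsto h4 hβ

/-! ### (iii) The registered stub -/

set_option linter.style.nameCheck false in
/-- Registered statement of `stub_seamFE` (name-keyed alias of the skeleton `Cruxes/SourcedPressureDecoupling/Lines/exact_seam.lean`,
restated verbatim: `Cruxes/` is not importable). -/
abbrev __Registered.stub_seamFE : Prop :=
  ∀ (G : Type) [Group G] [TopologicalSpace G] [IsTopologicalGroup G] [CompactSpace G], IsCompactSimpleLieGroup G → letI : MeasurableSpace G := borel G; haveI : BorelSpace G := ⟨rfl⟩; ∀ r : LatticeRep G, ∀ θ : ℝ, 0 < θ → θ ≤ 1 / 64 → ∃ κ₁ β₀ : ℝ, 0 < κ₁ ∧ ∀ β : ℝ, β₀ ≤ β → ∀ ℓ : ℕ, β ^ θ ≤ (ℓ + 1 : ℝ) → (ℓ + 1 : ℝ) ≤ 4 * β ^ θ →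
    freeEnergyPerSite r.ρ β (halfOpenBox 4 (ℓ + 1)) - freeEnergyDensity 4 r.ρ β ≤ β ^ (-κ₁)

/-- **Stub `stub_seamFE` of line «exact-seam»** (finite-size free-energy comparison at weak coupling): for every compact simple `G`,
lattice representation `r` and `0 < θ ≤ 1/64` there are `κ₁ > 0`, `β₀` such that `F(B_s, β) − f(β) ≤ β^(−κ₁)` for `β ≥ β₀` and every
free cube with `β^θ ≤ s ≤ 4β^θ` sites per axis.  Windowed Lemma 17.2 (`T_le_window`, `s ≤ 4β^θ ≤ β^{a_U}` as `θ ≤ 1/64 < 1/30`)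
against the torus lower rate (`freeEnergyDensity_lower` ∘ `FreeEnergyRate.stub_lowerRate`), with `3 − coef s = 4/s − s⁻⁴ ≤ 4β^(−θ)`.
[cite: arXiv160201222, Thm. 2.1, §17] -/
theorem stub_seamFE : __Registered.stub_seamFE := by
  intro G _ _ _ _ hG
  letI : MeasurableSpace G := borel G
  haveI : BorelSpace G := ⟨rfl⟩
  intro r θ hθ hθ64
  haveI : SecondCountableTopology (Matrix (Fin r.N) (Fin r.N) ℂ) :=
    inferInstanceAs (SecondCountableTopology (Fin r.N → Fin r.N → ℂ))
  haveI : SecondCountableTopology G :=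
    (r.continuous.isClosedEmbedding r.injective).isEmbedding.secondCountableTopology
  obtain ⟨B, hBlog, -⟩ :=
    exists_oneBoxBounds (d := 4) r.ρ (by norm_num) r.continuous r.injective r.mem_unitary
  obtain ⟨L, hL⟩ := LatticeMaxwell.tendsto_logZM_div (d := 4) (by norm_num)
  obtain ⟨CM, hCM⟩ := stub_maxwellRate (d := 4) (by norm_num) hL
  obtain ⟨κU, hκU, hU⟩ := T_le_window (d := 4) (by norm_num) B hCM hθ
  obtain ⟨κ₂, hκ₂, hLow⟩ := stub_lowerRate (d := 4) (by norm_num) B hCM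
  have hLow' := freeEnergyDensity_lower r B hBlog hLow
  have hD : (0 : ℝ) ≤ (B.D : ℝ) := Nat.cast_nonneg _
  -- the rate `κ₁` and the absorption of the three error terms
  set κ₁ : ℝ := min (min κU κ₂) θ / 2 with hκ₁
  have hmin0 : 0 < min (min κU κ₂) θ := lt_min (lt_min hκU hκ₂) hθ
  have hκ₁0 : 0 < κ₁ := by positivity
  have hk1 : κ₁ < κU := by
    have : min (min κU κ₂) θ ≤ κU := (min_le_left _ _).trans (min_le_left _ _)
    rw [hκ₁]; linarith
  have hk2 : κ₁ < κ₂ := by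
    have : min (min κU κ₂) θ ≤ κ₂ := (min_le_left _ _).trans (min_le_right _ _)
    rw [hκ₁]; linarith
  have hk3 : κ₁ < θ := by
    have : min (min κU κ₂) θ ≤ θ := min_le_right _ _
    rw [hκ₁]; linarith
  set E : ℝ → ℝ := fun β => β ^ (-κU) + β ^ (-κ₂) + 2 * (B.D : ℝ) * (β ^ (-θ) * Real.log β) with hE
  have hEt : Tendsto (fun β => β ^ κ₁ * E β) atTop (𝓝 0) := by
    have t1 := tendsto_rpow_mul_rpow (κ := κ₁) (p := -κU) (by linarith)
    have t2 := tendsto_rpow_mul_rpow (κ := κ₁) (p := -κ₂) (by linarith)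
    have t3 := (tendsto_rpow_mul_rpow_mul_log (κ := κ₁) (p := -θ) (by linarith)).const_mul (2 * (B.D : ℝ))
    have hsum := (t1.add t2).add t3
    simp only [mul_zero, add_zero] at hsum
    refine hsum.congr' (Eventually.of_forall fun β => ?_)
    simp only [hE]
    ring
  -- `4 β^θ ≤ β^{a_U}` eventually (`θ ≤ 1/64 < a_U = 1/30`)
  have haU : aU 4 = 1 / 30 := by norm_num [aU]
  have hgap : 0 < aU 4 - θ := by rw [haU]; linarith
  have hev4 : ∀ᶠ β : ℝ in atTop, (4 : ℝ) ≤ β ^ (aU 4 - θ) :=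
    (tendsto_rpow_atTop hgap).eventually_ge_atTop _
  have hev : ∀ᶠ β : ℝ in atTop, 2 ≤ β ∧ (4 : ℝ) ≤ β ^ (aU 4 - θ) ∧ E β ≤ β ^ (-κ₁) ∧
      (∀ m : ℕ, β ^ θ ≤ 2 * (m : ℝ) → (m : ℝ) ≤ β ^ aU 4 →
        B.T m β ≤ (((4 : ℕ) : ℝ) - 1) * Real.log B.cH + (B.D : ℝ) * L + β ^ (-κU)) ∧
      ((((4 : ℕ) : ℝ) - 1) * Real.log B.cH + (B.D : ℝ) * L - β ^ (-κ₂) ≤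
        freeEnergyDensity 4 r.ρ β + 3 / 2 * (B.D : ℝ) * Real.log β) := by
    refine (eventually_ge_atTop 2).and (hev4.and ((eventually_le_rpow_neg_of_tendsto hEt).and (hU.and hLow')))
  obtain ⟨β₀, hβ₀⟩ := Filter.eventually_atTop.1 hev
  refine ⟨κ₁, β₀, hκ₁0, fun β hβ ℓ hℓ1 hℓ2 => ?_⟩
  obtain ⟨hβ2, h4θ, hEle, hUβ, hLβ⟩ := hβ₀ β hβ
  have hβ0 : 0 < β := by linarith
  have hβ1 : 1 ≤ β := by linarith
  have hlog : 0 ≤ Real.log β := Real.log_nonneg hβ1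
  have hβθ : 0 < β ^ θ := Real.rpow_pos_of_pos hβ0 θ
  have hs0 : (0 : ℝ) < (ℓ : ℝ) + 1 := by positivity
  have hs1 : 1 ≤ ℓ + 1 := by omega
  -- the window lies in the one-box regime
  have hwin : β ^ θ * β ^ (aU 4 - θ) = β ^ aU 4 := by
    rw [← Real.rpow_add hβ0]; congr 1; ring
  have hsU : (((ℓ + 1 : ℕ) : ℝ)) ≤ β ^ aU 4 := by
    push_cast
    have := mul_le_mul_of_nonneg_left h4θ hβθ.le
    nlinarith [hwin]
  have hslo : β ^ θ ≤ 2 * (((ℓ + 1 : ℕ) : ℝ)) := by push_cast; linarith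
  have hTs := hUβ (ℓ + 1) hslo hsU
  -- `T(B_s, β) = F(B_s, β) + ½(3 − 4/s + s⁻⁴) D log β`
  have hT : B.T (ℓ + 1) β = freeEnergyPerSite r.ρ β (halfOpenBox 4 (ℓ + 1)) +
      3 / 2 * (B.D : ℝ) * Real.log β - 2 / ((ℓ : ℝ) + 1) * ((B.D : ℝ) * Real.log β) +
        1 / 2 * (1 / ((ℓ : ℝ) + 1) ^ 4) * ((B.D : ℝ) * Real.log β) := by
    rw [OneBoxBounds.T, OneBoxBounds.F, hBlog, ChatterjeeJointLimit.coef_eq (by norm_num) hs1,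
      ChatterjeeFreeEnergy.freeEnergyPerSite_halfOpenBox_eq]
    push_cast
    ring
  -- `1/s ≤ β^(−θ)`
  have hinv : 1 / ((ℓ : ℝ) + 1) ≤ β ^ (-θ) := by
    rw [Real.rpow_neg hβ0.le, ← one_div]
    exact one_div_le_one_div_of_le hβθ hℓ1
  have ha : 2 / ((ℓ : ℝ) + 1) * ((B.D : ℝ) * Real.log β) ≤ 2 * (B.D : ℝ) * (β ^ (-θ) * Real.log β) := by
    have hDl0 : 0 ≤ (B.D : ℝ) * Real.log β := by positivity
    have := mul_le_mul_of_nonneg_right hinv hDl0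
    calc 2 / ((ℓ : ℝ) + 1) * ((B.D : ℝ) * Real.log β) = 2 * (1 / ((ℓ : ℝ) + 1) * ((B.D : ℝ) * Real.log β)) := by ring
      _ ≤ 2 * (β ^ (-θ) * ((B.D : ℝ) * Real.log β)) := by linarith
      _ = 2 * (B.D : ℝ) * (β ^ (-θ) * Real.log β) := by ring
  have hb : 0 ≤ 1 / 2 * (1 / ((ℓ : ℝ) + 1) ^ 4) * ((B.D : ℝ) * Real.log β) := by positivity
  have hEβ : E β = β ^ (-κU) + β ^ (-κ₂) + 2 * (B.D : ℝ) * (β ^ (-θ) * Real.log β) := rfl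
  -- make the atoms opaque and conclude by linear arithmetic
  generalize freeEnergyPerSite r.ρ β (halfOpenBox 4 (ℓ + 1)) = F at hT ⊢
  generalize freeEnergyDensity 4 r.ρ β = f at hLβ ⊢
  generalize B.T (ℓ + 1) β = T at hT hTs
  generalize (((4 : ℕ) : ℝ) - 1) * Real.log B.cH + (B.D : ℝ) * L = A₀ at hTs hLβ
  generalize hDl : (B.D : ℝ) * Real.log β = Dl at hT hLβ ha hb hEβ
  have step1 : F - f ≤ β ^ (-κU) + β ^ (-κ₂) + 2 / ((ℓ : ℝ) + 1) * Dl := by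
    have e32 : 3 / 2 * (B.D : ℝ) * Real.log β = 3 / 2 * Dl := by rw [← hDl]; ring
    linarith [hT, hTs, hLβ, hb]
  have step2 : F - f ≤ E β := by
    rw [hEβ]
    have : 2 * (B.D : ℝ) * (β ^ (-θ) * Real.log β) = 2 * β ^ (-θ) * Dl := by
      rw [← hDl]; ring
    linarith [step1, ha]
  exact step2.trans hEle

end Summit.QuantumFields.YangMills.Cruxes.SourcedPressureDecoupling.EntropicSeam

end
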